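import Summits.QuantumFields.YangMills.Theorems.LuscherReductionTwistedTraceScalingBOStiffJumpMass
import Summits.QuantumFields.YangMills.Theorems.LuscherReductionTwistedTraceScalingBOStiffCentralUpper
import Summits.QuantumFields.YangMills.Theorems.LuscherReductionTwistedTraceScalingBOStiffCentralDensity
import HarnessLib

/-!
# (B-ST) atom (B4) ★★★ THE JUMP FLOOR `hJ` OF `spec_gap_inputs` WITH THE β-FREE CONSTANT `cJ = 1/6`, for the π-normalised model jump kernel `cJ0`
# (lane A of S-BASE, crux `TwistedTraceScaling` stmt-QuantumFields-20203, C4-CORE, the (B-ST) pen; `pub/ym-fleet/ym-luscher-20007-p1/HANDOFF-g22.md` §DESIGN 4, cdisprove UPDATE 24 (d))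

With the two-sided pointwise asymptotics of the central based kernel on the profile support — ✓`…BOStiffCentralLower.cM_lower` / ✓`…BOStiffCentralUpper.cM_upper`:
`(1−ε)·cA·cK ≤ cM ≤ (1+ε)·cA·cK + (e^{2β})^{|E|}e^{−ℓ⁴/(144L²)}` on `cS × cS` (objects of ✓`…BOStiffFlatDefs`) — the AMPLITUDE `cA` CANCELS between the jump floor and the level:
Data of `cK` and the floor `e^{−(64|P|+4)βr²}(∫cΘ)² ≤ cIk`: ✓`…BOStiffJumpMass`.
* §1 ★★ `cLambda_mul_cZ_le`: eventually `cΛ·cZ ≤ (3/2)·cA·cIk + (e^{2β})^{|E|}e^{−ℓ⁴/(144L²)}·(∫cΘ dπ)²` (integrate `cM_upper` at `ε = 1/2` against `cΘ ⊗ cΘ`), and ★★ `tail_le_cIk`: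
  eventually the tail is `≤ (3/2)·cA·cIk` (superpolynomial `e^{−ℓ⁴}` against `β^{-d/2}e^{−O(ℓ²)}`), so ★★ `cLambda_mul_cZ_le_three`: `cΛ·cZ ≤ 3·cA·cIk`;
* §2 ★★★ `hJ_record` — for `L` with a non-zero site, EVENTUALLY IN `β`, for ALL `s, M` and all `x, y`:
  `(1/6)·(cΛ L s M β · cJ0 L s M β x y) ≤ cΘ L β x · cM L β x y · cΘ L β y`
  (`cJ0 = cΘ⊗cΘ·cK·cZ/cIk`; on `cS²`: `cΛ·cJ0 ≤ 3cA·cΘ cK cΘ` and `(1/2)cA·cK ≤ cM`; off `cS²` both sides vanish) — the LITERAL `hJ` clause of `spec_gap_inputs` with `cJ = 1/6`,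
  `Λ = cΛ`, `J₀ = cJ0`, and NO use of the fibre measure's density (PiDensity enters only `hflat`);
* §3 the data clauses of `spec_gap_inputs` for `J₀ = cJ0`: `measurable_cJ0`, `abs_cJ0_le`.
HONEST FRAMING: the jump-floor half of `spec_gap_inputs` for a stub of a child of the CONDITIONAL route R2b1; `hflat` (Mehler ⊗ resampling for `(cD, cJ0)`, needs PiDensity) and (A)
remain; (B-ST) OPEN; C4-CORE OPEN; not infinite volume, not a gap, not Clay.
-/

set_option autoImplicit false

noncomputable section

open MeasureTheory Filter Topology Real
open scoped BigOperators
open Literature.MathematicalPhysics.QuantumFieldTheory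
open Literature.MathematicalPhysics.QuantumLattice

namespace Summit.QuantumFields.YangMills.Theorems.FemtoTransferGap.TwoLattice.ConstTube

open Summit.QuantumFields.YangMills.Theorems.FemtoTransferGap
open Summit.QuantumFields.YangMills.Theorems.FemtoTransferGap.TwoLattice
open Summit.QuantumFields.YangMills.Theorems.FemtoTransferGap.TwoLattice.Avg
open Summit.QuantumFields.YangMills.Theorems.FemtoTransferGap.TwoLattice.Stiff
open Summit.QuantumFields.YangMills.Theorems.FemtoTransferGap.TwoLattice.GnChart
open Summit.QuantumFields.YangMills.Theorems.FemtoTransferGap.TwoLattice.Cov (scalarPart_inv vecPart_inv)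

variable {L : ℕ} [NeZero L]

/-! ## §1 The level against the jump mass: `cΛ·cZ ≤ 3·cA·cIk` eventually -/

/-- The off-core tail of `cM_upper`. -/
private theorem tail_nonneg (β : ℝ) : 0 ≤ Real.exp (2 * β) ^ Fintype.card (Edge 3 L) * Real.exp (-(btLog β ^ 4 / (144 * (L : ℝ) ^ 2))) := by positivity

set_option maxHeartbeats 800000 in
-- long product-measure bookkeeping.
/-- ★★ **Integrating the upper twin against `cΘ ⊗ cΘ`**: eventually in `β`, for all `s, M`,
`cΛ·cZ ≤ (3/2)·cA·cIk + (e^{2β})^{|E|}e^{−ℓ⁴/(144L²)}·(∫cΘ dπ)²`. [cite: Luscher1983, §3] -/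
theorem cLambda_mul_cZ_le (hL : Nonempty (NzSite L)) :
    ∀ᶠ β : ℝ in atTop, ∀ s M : ℝ, cΛ L s M β * cZ L s M β ≤
      3 / 2 * cA L β * cIk L β + Real.exp (2 * β) ^ Fintype.card (Edge 3 L) * Real.exp (-(btLog β ^ 4 / (144 * (L : ℝ) ^ 2))) * (∫ x, cΘ L β x ∂orthoTransverse L) ^ 2 := by
  haveI := isFiniteMeasure_orthoTransverse L
  filter_upwards [cM_upper (L := L) hL (by norm_num : (0 : ℝ) < 1 / 2), eventually_ge_atTop (0 : ℝ)] with β hup hβ s M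
  set t := Real.exp (2 * β) ^ Fintype.card (Edge 3 L) * Real.exp (-(btLog β ^ 4 / (144 * (L : ℝ) ^ 2))) with ht
  have ht0 : 0 ≤ t := tail_nonneg (L := L) β
  obtain ⟨hΘm, hΘ1, hΘ0⟩ := cΘ_data (L := L) β
  have hKm := measurable_cK (L := L) β
  have hK1 : ∀ x y, |cK L β x y| ≤ 1 := fun x y => by
    obtain ⟨h0, h1⟩ := cK_pos_le_one (L := L) hβ x y; rw [abs_of_pos h0]; exact h1
  have hA0 := (cA_pos (L := L) β).le
  -- the numerator of cΛ
  set N := ∫ x, ∫ y, cΘ L β x * cM L β x y * cΘ L β y ∂orthoTransverse L ∂orthoTransverse L with hN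
  have hRHS0 : 0 ≤ 3 / 2 * cA L β * cIk L β + t * (∫ x, cΘ L β x ∂orthoTransverse L) ^ 2 := by
    have := (cIk_pos (L := L) hβ).le; positivity
  -- pointwise
  obtain ⟨CM, hCM⟩ := cM_bounds (L := L) β
  have hpt : ∀ p : (Edge 3 L → Fin 3 → ℝ) × (Edge 3 L → Fin 3 → ℝ),
      cΘ L β p.1 * cM L β p.1 p.2 * cΘ L β p.2 ≤ 3 / 2 * cA L β * (cΘ L β p.1 * cK L β p.1 p.2 * cΘ L β p.2) + t * (cΘ L β p.1 * cΘ L β p.2) := by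
    rintro ⟨x, y⟩
    simp only
    by_cases hx : x ∈ cS L β
    · by_cases hy : y ∈ cS L β
      · have h := hup x hx y hy
        change cM L β x y ≤ (1 + 1 / 2) * (cA L β * cK L β x y) + t at h
        have := mul_le_mul_of_nonneg_left h (mul_nonneg (hΘ0 x) (hΘ0 y))
        nlinarith [this]
      · rw [cΘ_eq_zero_of_not_mem_cS β y hy]; simp
    · rw [cΘ_eq_zero_of_not_mem_cS β x hx]; simp
  have hF : Measurable fun p : (Edge 3 L → Fin 3 → ℝ) × (Edge 3 L → Fin 3 → ℝ) => cΘ L β p.1 * cM L β p.1 p.2 * cΘ L β p.2 :=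
    ((hΘm.comp measurable_fst).mul (measurable_cM (L := L) β)).mul (hΘm.comp measurable_snd)
  have hFb : ∀ p : (Edge 3 L → Fin 3 → ℝ) × (Edge 3 L → Fin 3 → ℝ), |cΘ L β p.1 * cM L β p.1 p.2 * cΘ L β p.2| ≤ CM := fun p => by
    rw [abs_mul, abs_mul]
    have hC0 : 0 ≤ CM := (abs_nonneg _).trans (hCM p.1 p.2).2.2
    have h12 : |cΘ L β p.1| * |cM L β p.1 p.2| ≤ CM := by
      calc |cΘ L β p.1| * |cM L β p.1 p.2| ≤ 1 * CM := mul_le_mul (hΘ1 _) (hCM _ _).2.2 (abs_nonneg _) zero_le_one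
        _ = CM := one_mul _
    calc |cΘ L β p.1| * |cM L β p.1 p.2| * |cΘ L β p.2| ≤ CM * 1 := mul_le_mul h12 (hΘ1 _) (abs_nonneg _) hC0
      _ = CM := mul_one _
  have hG : Measurable fun p : (Edge 3 L → Fin 3 → ℝ) × (Edge 3 L → Fin 3 → ℝ) =>
      3 / 2 * cA L β * (cΘ L β p.1 * cK L β p.1 p.2 * cΘ L β p.2) + t * (cΘ L β p.1 * cΘ L β p.2) :=
    ((((hΘm.comp measurable_fst).mul hKm).mul (hΘm.comp measurable_snd)).const_mul _).add (((hΘm.comp measurable_fst).mul (hΘm.comp measurable_snd)).const_mul _)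
  have hG1 : ∀ p : (Edge 3 L → Fin 3 → ℝ) × (Edge 3 L → Fin 3 → ℝ), |cΘ L β p.1 * cK L β p.1 p.2 * cΘ L β p.2| ≤ 1 := fun p => by
    rw [abs_mul, abs_mul]; exact mul_le_one₀ (mul_le_one₀ (hΘ1 _) (abs_nonneg _) (hK1 _ _)) (abs_nonneg _) (hΘ1 _)
  have hG2 : ∀ p : (Edge 3 L → Fin 3 → ℝ) × (Edge 3 L → Fin 3 → ℝ), |cΘ L β p.1 * cΘ L β p.2| ≤ 1 := fun p => by
    rw [abs_mul]; exact mul_le_one₀ (hΘ1 _) (abs_nonneg _) (hΘ1 _)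
  have hGb : ∀ p : (Edge 3 L → Fin 3 → ℝ) × (Edge 3 L → Fin 3 → ℝ),
      |3 / 2 * cA L β * (cΘ L β p.1 * cK L β p.1 p.2 * cΘ L β p.2) + t * (cΘ L β p.1 * cΘ L β p.2)| ≤ 3 / 2 * cA L β + t := fun p => by
    calc _ ≤ |3 / 2 * cA L β * (cΘ L β p.1 * cK L β p.1 p.2 * cΘ L β p.2)| + |t * (cΘ L β p.1 * cΘ L β p.2)| := abs_add_le _ _
      _ = 3 / 2 * cA L β * |cΘ L β p.1 * cK L β p.1 p.2 * cΘ L β p.2| + t * |cΘ L β p.1 * cΘ L β p.2| := by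
          rw [abs_mul, abs_mul t, abs_of_nonneg (by positivity : (0:ℝ) ≤ 3 / 2 * cA L β), abs_of_nonneg ht0]
      _ ≤ 3 / 2 * cA L β * 1 + t * 1 := add_le_add (mul_le_mul_of_nonneg_left (hG1 p) (by positivity)) (mul_le_mul_of_nonneg_left (hG2 p) ht0)
      _ = 3 / 2 * cA L β + t := by ring
  have hmono := iter_integral_mono (μ := orthoTransverse L) (ν := orthoTransverse L) hF hFb hG hGb hpt
  have hlin := iter_integral_lin (L := L) (F := fun p => cΘ L β p.1 * cK L β p.1 p.2 * cΘ L β p.2) (G := fun p => cΘ L β p.1 * cΘ L β p.2)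
    (((hΘm.comp measurable_fst).mul hKm).mul (hΘm.comp measurable_snd)) hG1 ((hΘm.comp measurable_fst).mul (hΘm.comp measurable_snd)) hG2 (3 / 2 * cA L β) t
  dsimp only at hmono hlin
  rw [hlin, iter_integral_cΘ_sq] at hmono
  have hNle : N ≤ 3 / 2 * cA L β * cIk L β + t * (∫ x, cΘ L β x ∂orthoTransverse L) ^ 2 := hmono
  -- cΛ·cZ = N or 0
  have hΛ : cΛ L s M β = N / cZ L s M β := rfl
  by_cases hZ : cZ L s M β = 0
  · rw [hZ, mul_zero]; exact hRHS0
  · rw [hΛ, div_mul_cancel₀ _ hZ]; exact hNle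

set_option maxHeartbeats 800000 in
-- many explicit constants.
/-- ★★ **The tail is negligible against the jump mass**: eventually `(e^{2β})^{|E|}e^{−ℓ⁴/(144L²)}·(∫cΘ dπ)² ≤ (3/2)·cA·cIk`
(superpolynomial `e^{−ℓ⁴}` against `β^{-d/2}e^{−(64|P|+4)ℓ²}`). [folklore] -/
theorem tail_le_cIk : ∀ᶠ β : ℝ in atTop,
    Real.exp (2 * β) ^ Fintype.card (Edge 3 L) * Real.exp (-(btLog β ^ 4 / (144 * (L : ℝ) ^ 2))) * (∫ x, cΘ L β x ∂orthoTransverse L) ^ 2 ≤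
      3 / 2 * cA L β * cIk L β := by
  set d2 : ℝ := (flatDim L / 2 : ℝ) with hd2
  have hd2_0 : 0 ≤ d2 := by positivity
  set c₀ : ℝ := ((2 * π ^ 2)⁻¹) ^ Fintype.card (NzSite L) / Real.sqrt (gramDet L 0) with hc₀
  have hg0 : 0 < Real.sqrt (gramDet L 0) := Real.sqrt_pos.2 (gramDet_zero_pos L)
  have hc₀0 : 0 < c₀ := by positivity
  set CP : ℝ := 64 * Fintype.card (Plaquette 3 L) + 4 with hCP
  have hCP0 : 0 ≤ CP := by positivity
  set K : ℝ := |Real.log (3 / 2 * c₀)| with hK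
  have hL1 : (1 : ℝ) ≤ L := by exact_mod_cast Nat.one_le_iff_ne_zero.2 (NeZero.ne L)
  -- eventually ℓ² ≥ 144L²(CP + d2 + K + 1)
  have hl : ∀ᶠ β : ℝ in atTop, Real.sqrt (144 * (L : ℝ) ^ 2 * (CP + d2 + K + 1)) ≤ btLog β := tendsto_btLog_atTop.eventually (eventually_ge_atTop _)
  filter_upwards [hl, eventually_ge_atTop (1 : ℝ)] with β hlβ hβ1
  have hβ0 : 0 < β := by linarith
  set ℓ := btLog β with hℓ
  have hℓ1 : 1 ≤ ℓ := one_le_btLog β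
  have hℓ2 : 144 * (L : ℝ) ^ 2 * (CP + d2 + K + 1) ≤ ℓ ^ 2 := by
    have h0 : 0 ≤ 144 * (L : ℝ) ^ 2 * (CP + d2 + K + 1) := by positivity
    calc 144 * (L : ℝ) ^ 2 * (CP + d2 + K + 1) = Real.sqrt (144 * (L : ℝ) ^ 2 * (CP + d2 + K + 1)) ^ 2 := (Real.sq_sqrt h0).symm
      _ ≤ ℓ ^ 2 := pow_le_pow_left₀ (Real.sqrt_nonneg _) hlβ 2
  -- the exponent inequality: −ℓ⁴/(144L²) ≤ −K − d2·ℓ − CP·ℓ²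
  have hexp : -(ℓ ^ 4 / (144 * (L : ℝ) ^ 2)) ≤ -K - d2 * ℓ - CP * ℓ ^ 2 := by
    have hL2 : 0 < 144 * (L : ℝ) ^ 2 := by positivity
    have h1 : (CP + d2 + K + 1) * ℓ ^ 2 ≤ ℓ ^ 4 / (144 * (L : ℝ) ^ 2) := by
      rw [le_div_iff₀ hL2]
      have := mul_le_mul_of_nonneg_right hℓ2 (sq_nonneg ℓ)
      nlinarith
    have hℓsq : ℓ ≤ ℓ ^ 2 := by nlinarith
    have h1sq : 1 ≤ ℓ ^ 2 := by nlinarith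
    have h2 : d2 * ℓ ≤ d2 * ℓ ^ 2 := mul_le_mul_of_nonneg_left hℓsq hd2_0
    have h3 : K ≤ K * ℓ ^ 2 := le_mul_of_one_le_right (abs_nonneg _) h1sq
    nlinarith [sq_nonneg ℓ]
  -- sizes: βr² ≤ ℓ², fpWeightBar(β^{-1/2}) ≥ c₀ e^{−d2 ℓ}
  have hps : powScale (1 / 2) β ^ 2 = β⁻¹ := powScale_half_sq hβ1
  have hr2 : β * (min (1 / 40) (powScale (1 / 2) β * btLog β)) ^ 2 ≤ ℓ ^ 2 := by
    have h1 : (min (1 / 40) (powScale (1 / 2) β * btLog β)) ^ 2 ≤ (powScale (1 / 2) β * btLog β) ^ 2 :=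
      pow_le_pow_left₀ (le_min (by norm_num) (by have := powScale_pos (1/2) β; positivity)) (min_le_right _ _) 2
    calc β * (min (1 / 40) (powScale (1 / 2) β * btLog β)) ^ 2 ≤ β * (powScale (1 / 2) β * btLog β) ^ 2 := mul_le_mul_of_nonneg_left h1 hβ0.le
      _ = (β * powScale (1 / 2) β ^ 2) * ℓ ^ 2 := by ring
      _ = ℓ ^ 2 := by rw [hps, mul_inv_cancel₀ hβ0.ne', one_mul]
  have hlogβ : Real.log β ≤ ℓ := le_max_left _ _
  have hfp : c₀ * Real.exp (-(d2 * ℓ)) ≤ fpWeightBar L (powScale (1 / 2) β) := by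
    have e : fpWeightBar L (powScale (1 / 2) β) = c₀ * (π * β⁻¹) ^ d2 := by
      unfold fpWeightBar; rw [hps, hc₀, hd2]; ring
    rw [e]
    refine mul_le_mul_of_nonneg_left ?_ hc₀0.le
    have h1 : Real.exp (-(d2 * ℓ)) ≤ β⁻¹ ^ d2 := by
      rw [Real.rpow_def_of_pos (inv_pos.2 hβ0), Real.log_inv]
      exact Real.exp_le_exp.2 (by nlinarith)
    have h2 : β⁻¹ ^ d2 ≤ (π * β⁻¹) ^ d2 :=
      Real.rpow_le_rpow (inv_pos.2 hβ0).le (le_mul_of_one_le_left (inv_pos.2 hβ0).le (by linarith [Real.pi_gt_three])) hd2_0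
    exact h1.trans h2
  -- assemble
  have hI := cIk_ge (L := L) hβ0.le
  have hE0 : 0 < Real.exp (2 * β) ^ Fintype.card (Edge 3 L) := pow_pos (Real.exp_pos _) _
  have hI0 : 0 ≤ (∫ x, cΘ L β x ∂orthoTransverse L) ^ 2 := sq_nonneg _
  have key : Real.exp (-(btLog β ^ 4 / (144 * (L : ℝ) ^ 2))) ≤ 3 / 2 * fpWeightBar L (powScale (1 / 2) β) * Real.exp (-(CP * β * (min (1 / 40) (powScale (1 / 2) β * btLog β)) ^ 2)) := by
    have h1 : Real.exp (-(ℓ ^ 4 / (144 * (L : ℝ) ^ 2))) ≤ Real.exp (-K - d2 * ℓ - CP * ℓ ^ 2) := Real.exp_le_exp.2 hexp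
    have h2 : Real.exp (-K - d2 * ℓ - CP * ℓ ^ 2) = Real.exp (-K) * Real.exp (-(d2 * ℓ)) * Real.exp (-(CP * ℓ ^ 2)) := by
      rw [← Real.exp_add, ← Real.exp_add]; ring_nf
    have h3 : Real.exp (-K) ≤ 3 / 2 * c₀ := by
      have : -K ≤ Real.log (3 / 2 * c₀) := by rw [hK]; exact neg_abs_le _
      calc Real.exp (-K) ≤ Real.exp (Real.log (3 / 2 * c₀)) := Real.exp_le_exp.2 this
        _ = 3 / 2 * c₀ := Real.exp_log (by positivity)
    have h4 : Real.exp (-(CP * ℓ ^ 2)) ≤ Real.exp (-(CP * β * (min (1 / 40) (powScale (1 / 2) β * btLog β)) ^ 2)) := by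
      refine Real.exp_le_exp.2 (neg_le_neg ?_)
      have := mul_le_mul_of_nonneg_left hr2 hCP0
      nlinarith
    calc Real.exp (-(btLog β ^ 4 / (144 * (L : ℝ) ^ 2))) ≤ Real.exp (-K) * Real.exp (-(d2 * ℓ)) * Real.exp (-(CP * ℓ ^ 2)) := by rw [← h2]; exact h1
      _ ≤ (3 / 2 * c₀) * Real.exp (-(d2 * ℓ)) * Real.exp (-(CP * β * (min (1 / 40) (powScale (1 / 2) β * btLog β)) ^ 2)) := by
          gcongr
      _ = 3 / 2 * (c₀ * Real.exp (-(d2 * ℓ))) * Real.exp (-(CP * β * (min (1 / 40) (powScale (1 / 2) β * btLog β)) ^ 2)) := by ring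
      _ ≤ 3 / 2 * fpWeightBar L (powScale (1 / 2) β) * Real.exp (-(CP * β * (min (1 / 40) (powScale (1 / 2) β * btLog β)) ^ 2)) := by
          gcongr
  calc Real.exp (2 * β) ^ Fintype.card (Edge 3 L) * Real.exp (-(btLog β ^ 4 / (144 * (L : ℝ) ^ 2))) * (∫ x, cΘ L β x ∂orthoTransverse L) ^ 2
      ≤ Real.exp (2 * β) ^ Fintype.card (Edge 3 L) * (3 / 2 * fpWeightBar L (powScale (1 / 2) β) * Real.exp (-(CP * β * (min (1 / 40) (powScale (1 / 2) β * btLog β)) ^ 2))) *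
          (∫ x, cΘ L β x ∂orthoTransverse L) ^ 2 := by gcongr
    _ = 3 / 2 * cA L β * (Real.exp (-(CP * β * (min (1 / 40) (powScale (1 / 2) β * btLog β)) ^ 2)) * (∫ x, cΘ L β x ∂orthoTransverse L) ^ 2) := by
          unfold cA; ring
    _ ≤ 3 / 2 * cA L β * cIk L β := by
          have hA := (cA_pos (L := L) β).le
          exact mul_le_mul_of_nonneg_left hI (by positivity)

/-- ★★ **`cΛ·cZ ≤ 3·cA·cIk`** eventually in `β`, for all `s, M`. [cite: Luscher1983, §3] -/
theorem cLambda_mul_cZ_le_three (hL : Nonempty (NzSite L)) : ∀ᶠ β : ℝ in atTop, ∀ s M : ℝ, cΛ L s M β * cZ L s M β ≤ 3 * cA L β * cIk L β := by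
  filter_upwards [cLambda_mul_cZ_le (L := L) hL, tail_le_cIk (L := L)] with β h1 h2 s M
  have := h1 s M; linarith

/-! ## §2 ★★★ The jump floor `hJ` -/

/-- ★★★ **THE JUMP FLOOR `hJ` WITH `cJ = 1/6`**: for `L` with a non-zero site, eventually in `β`, for all `s, M, x, y`:
`(1/6)·(cΛ L s M β · cJ0 L s M β x y) ≤ cΘ L β x · cM L β x y · cΘ L β y`. [cite: Luscher1983, §3] [cite: SjostrandZworski2007, §2] -/
theorem hJ_record (hL : Nonempty (NzSite L)) :
    ∀ᶠ β : ℝ in atTop, ∀ s M : ℝ, ∀ x y : Edge 3 L → Fin 3 → ℝ, 1 / 6 * (cΛ L s M β * cJ0 L s M β x y) ≤ cΘ L β x * cM L β x y * cΘ L β y := by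
  filter_upwards [cLambda_mul_cZ_le_three (L := L) hL, cM_lower (L := L) hL (by norm_num : (0 : ℝ) < 1 / 2), eventually_ge_atTop (0 : ℝ)] with β h3 hlow hβ s M x y
  obtain ⟨-, -, hΘ0⟩ := cΘ_data (L := L) β
  by_cases hx : x ∈ cS L β
  · by_cases hy : y ∈ cS L β
    · have hI := cIk_pos (L := L) hβ
      have hK0 := (cK_pos_le_one (L := L) hβ x y).1
      have hlo := hlow x hx y hy
      change (1 - 1 / 2) * (cA L β * cK L β x y) ≤ cM L β x y at hlo
      have hΘΘ : 0 ≤ cΘ L β x * cK L β x y * cΘ L β y := mul_nonneg (mul_nonneg (hΘ0 x) hK0.le) (hΘ0 y)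
      -- cΛ·cJ0 = (cΛ·cZ)/cIk · ΘKΘ ≤ 3cA·ΘKΘ
      have e : cΛ L s M β * cJ0 L s M β x y = (cΛ L s M β * cZ L s M β) / cIk L β * (cΘ L β x * cK L β x y * cΘ L β y) := by
        unfold cJ0; field_simp
      have h1 : cΛ L s M β * cJ0 L s M β x y ≤ 3 * cA L β * (cΘ L β x * cK L β x y * cΘ L β y) := by
        rw [e]
        exact mul_le_mul_of_nonneg_right ((div_le_iff₀ hI).2 (h3 s M)) hΘΘ
      have h2 : cΘ L β x * (1 / 2 * (cA L β * cK L β x y)) * cΘ L β y ≤ cΘ L β x * cM L β x y * cΘ L β y := by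
        have : (1 - 1 / 2 : ℝ) = 1 / 2 := by norm_num
        rw [this] at hlo
        exact mul_le_mul_of_nonneg_right (mul_le_mul_of_nonneg_left hlo (hΘ0 x)) (hΘ0 y)
      nlinarith
    · have hΘy : cΘ L β y = 0 := cΘ_eq_zero_of_not_mem_cS β y hy
      unfold cJ0; rw [hΘy]; simp
  · have hΘx : cΘ L β x = 0 := cΘ_eq_zero_of_not_mem_cS β x hx
    unfold cJ0; rw [hΘx]; simp

/-! ## §3 The data clauses of `spec_gap_inputs` for `J₀ = cJ0`, `D = cD` -/

/-- `cJ0` is jointly measurable. [folklore] -/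
theorem measurable_cJ0 (s M β : ℝ) : Measurable (Function.uncurry (cJ0 L s M β)) := by
  have hΘm := measurable_cΘ (L := L) β
  have h : Measurable fun p : (Edge 3 L → Fin 3 → ℝ) × (Edge 3 L → Fin 3 → ℝ) => cΘ L β p.1 * cK L β p.1 p.2 * cΘ L β p.2 * (cZ L s M β / cIk L β) :=
    (((hΘm.comp measurable_fst).mul (measurable_cK (L := L) β)).mul (hΘm.comp measurable_snd)).mul_const _
  exact h

/-- `0 ≤ cZ`. [folklore] -/
theorem cZ_nonneg (s M β : ℝ) : 0 ≤ cZ L s M β := by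
  unfold cZ
  exact integral_nonneg fun x => mul_nonneg (sq_nonneg _) ((softWeight_recordChi_props (L := L) s 43 M β).2.2.1 _)

/-- `|cJ0| ≤ cZ/cIk` (`β ≥ 0`). [folklore] -/
theorem abs_cJ0_le {β : ℝ} (hβ : 0 ≤ β) (s M : ℝ) (x y : Edge 3 L → Fin 3 → ℝ) : |cJ0 L s M β x y| ≤ cZ L s M β / cIk L β := by
  obtain ⟨-, hΘ1, -⟩ := cΘ_data (L := L) β
  have hK := cK_pos_le_one (L := L) hβ x y
  have hq : 0 ≤ cZ L s M β / cIk L β := div_nonneg (cZ_nonneg (L := L) s M β) (cIk_pos (L := L) hβ).le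
  unfold cJ0
  rw [abs_mul, abs_of_nonneg hq, abs_mul, abs_mul, abs_of_pos hK.1]
  have h1 : |cΘ L β x| * cK L β x y * |cΘ L β y| ≤ 1 := mul_le_one₀ (mul_le_one₀ (hΘ1 _) hK.1.le hK.2) (abs_nonneg _) (hΘ1 _)
  calc |cΘ L β x| * cK L β x y * |cΘ L β y| * (cZ L s M β / cIk L β) ≤ 1 * (cZ L s M β / cIk L β) := mul_le_mul_of_nonneg_right h1 hq
    _ = _ := one_mul _

/-- `cJ0` is symmetric. [folklore] -/
theorem cJ0_symm (s M β : ℝ) (x y : Edge 3 L → Fin 3 → ℝ) : cJ0 L s M β x y = cJ0 L s M β y x := by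
  unfold cJ0; rw [cK_symm]; ring

/-- `cD` is measurable, positive and bounded by `N̄(β⁻¹)`. [folklore] -/
theorem cD_data (β : ℝ) : Measurable (cD L β) ∧ (∀ x, 0 < cD L β x) ∧ (∀ x, |cD L β x| ≤ fpWeightBar L (powScale 1 β)) := by
  refine ⟨measurable_central_density (L := L) β, fun x => central_density_pos (L := L) β x, fun x => ?_⟩
  have h0 := central_density_pos (L := L) β x
  change 0 < cD L β x at h0
  rw [abs_of_pos h0]
  unfold cD
  have h1 : Real.exp (-(‖(gaugeModes L).starProjection (linkEmbed L x)‖ ^ 2 / powScale 1 β ^ 2)) ≤ 1 := Real.exp_le_one_iff.2 (by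
    have : 0 ≤ ‖(gaugeModes L).starProjection (linkEmbed L x)‖ ^ 2 / powScale 1 β ^ 2 := by positivity
    linarith)
  have h2 : Real.exp (-(2 * stiffGaussExp L (β / 2) β (linkEmbed L x))) ≤ 1 := Real.exp_le_one_iff.2 (by have := stiffGaussExp_nonneg (L := L) (β/2) β (linkEmbed L x); linarith)
  have hN := (fpWeightBar_pos L (powScale_pos 1 β)).le
  calc fpWeightBar L (powScale 1 β) * (Real.exp (-(‖(gaugeModes L).starProjection (linkEmbed L x)‖ ^ 2 / powScale 1 β ^ 2)) * Real.exp (-(2 * stiffGaussExp L (β / 2) β (linkEmbed L x))))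
      ≤ fpWeightBar L (powScale 1 β) * (1 * 1) := by gcongr
    _ = _ := by ring

end Summit.QuantumFields.YangMills.Theorems.FemtoTransferGap.TwoLattice.ConstTube

end
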